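import Summits.BirchSwinnertonDyer.BirchSwinnertonDyer.Theses.SemiOrdinaryEisensteinDescent
import Summits.BirchSwinnertonDyer.BirchSwinnertonDyer.Theorems.SemiOrdinaryEisensteinDescentWildKolyvaginUpperAtThreeTowerFreeJetchevMaxModThree
import Literature.NumberTheory.GaloisCohomology.LocalInvariantMapConjCompatible
import HarnessLib

/-!
# Route `SemiOrdinaryEisensteinDescent` rev 18: the tree-debt item `JetchevMaxDivisibilityAtThreeModThree`
# (stmt-BirchSwinnertonDyer-25897, pen act G) from the CONJUGATION-COMPATIBLE Poitou–Tate fact — and why the item as typed is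
# one conjunct short (width seat `bsd-wall-soed-p2-w2` g5; `--supports stmt-…-25897`, helper)

`JetchevMaxDivisibilityAtThreeModThree := PoitouTateSelmerStructureDualityFact → GrossHeegnerPointE0Input →
GrossProp372FrobeniusCongruenceInput → hJmax` where `hJmax` is Jetchev's max-form divisibility at `3 ∣ N` under `ρ̄₃` onto only
(the display of p598295 §2), and `PoitouTateSelmerStructureDualityFact := ∀ K, poitouTate_selmerStructure_duality K` is the
FOUR-conjunct Selmer-structure duality (one family of local invariant maps with IsPerfect ∧ SumLocalTermEqZero ∧
UnramifiedOrthogonal ∧ SelmerComplement). The tree's proof of `hJmax` — `jetchevMaxModThree_of_literature` (p606426) over the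
JET ModP series = cell `bsd-jet`'s road K — runs Jetchev's Thm. 5.1 SIGN BY SIGN on the `τ`-eigenspaces
(`Rank1ResidualJetSignedGlobalDuality[Plus]`, hypothesis `hinv`), which needs the FIFTH printed property of the invariant maps,
compatibility with the Galois transport of completions (`LocalInvariants.IsConjCompatible`; Neukirch III §6), i.e. the
FIVE-conjunct fact `poitouTate_selmerStructure_duality_conj` (`Literature/…/PoitouTateSelmerStructuresConj.lean`; PrintX9 /
PrintX10b `PoitouTateSelmerDuality`, KatoDescent(Tame)PotSupersingular `HeldPoitouTateSelmerDuality` are keyed to it). The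
four-conjunct fact asserts SOME family and does not give the fifth (for THE canonical family the fifth is the tree theorem
`isConjCompatible_canonical`, and both facts follow from the canonical family's UnramifiedOrthogonal ∧ SelmerComplement,
`poitouTate_selmerStructure_duality{_conj}_of_canonical_numberField`). So:
* `jetchevMaxDivisibilityAtThreeModThree_of_dualityConj` — **the item 25897 ⟸ `∀ K, poitouTate_selmerStructure_duality_conj K`**
  (its own PT antecedent is then not used); CONDITIONAL-RESULT for 25897 as typed;
* `jetchevMaxDivisibilityAtThreeModThree_of_canonical` — the item ⟸ the canonical family's two remaining printed properties
  (UnramifiedOrthogonal, SelmerComplement) at every number field, via `poitouTate_selmerStructure_duality_conj_of_canonical_numberField`.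
PEN TURNKEY (not executed here — no route-edit role): re-type the item's first antecedent as
`(∀ (K : Type) [Field K] [NumberField K], Literature.NumberTheory.GaloisCohomology.poitouTate_selmerStructure_duality_conj K) →`
(or attach that fact as a by-name support item and key the kernel's Jmax feed to it); the re-typed item closes by
`fun hPTc hE0 h372 ↦ WildKolyvaginUpperAtThreeTowerFreeJetchevMaxModThree.jetchevMaxModThree_of_literature hPTc hE0 h372`.
HONEST FRAMING: conditional theorems; the Poitou–Tate facts, E0 and 3.7 (2) are named print, undischarged; BSD is not proved.
References: [cite: MilneADT2006, Ch. I, Thm. 4.10(b)] [cite: Neukirch2013, Ch. III §6] [cite: Jetchev2008, Thm. 1.4, Thm. 5.1]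
[cite: Howard2004HeegnerKolyvagin, Thm. 2.1.11].
-/

set_option autoImplicit false
set_option linter.dupNamespace false -- `Summit.BirchSwinnertonDyer.BirchSwinnertonDyer.…` is the tree's layout (D-0017)

namespace Summit.BirchSwinnertonDyer.BirchSwinnertonDyer.Theorems.JetchevMaxDivisibilityAtThreeModThreeOfConj

open Literature.NumberTheory.GaloisCohomology
  Summit.BirchSwinnertonDyer.BirchSwinnertonDyer.Theses.SemiOrdinaryEisensteinDescent

/-- **Item `JetchevMaxDivisibilityAtThreeModThree` (25897) ⟸ the FIVE-conjunct Poitou–Tate fact for Selmer structures**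
(`∀ K, poitouTate_selmerStructure_duality_conj K`): by `jetchevMaxModThree_of_literature` (p606426); the item's own four-conjunct
antecedent `PoitouTateSelmerStructureDualityFact` is not used. CONDITIONAL on the displayed hypothesis.
[cite: MilneADT2006, Ch. I, Thm. 4.10(b)] [cite: Neukirch2013, Ch. III §6] [cite: Jetchev2008, Thm. 1.4 (p. 812)] -/
theorem jetchevMaxDivisibilityAtThreeModThree_of_dualityConj
    (hPTc : ∀ (K : Type) [Field K] [NumberField K], poitouTate_selmerStructure_duality_conj K) :
    JetchevMaxDivisibilityAtThreeModThree := by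
  intro _ hE0 h372
  exact WildKolyvaginUpperAtThreeTowerFreeJetchevMaxModThree.jetchevMaxModThree_of_literature hPTc hE0 h372

/-- **Item `JetchevMaxDivisibilityAtThreeModThree` (25897) ⟸ the two remaining printed properties of THE canonical family of
local invariant maps** (UnramifiedOrthogonal, Milne I Thm. 2.6; SelmerComplement, Milne I Thm. 4.10(b) `⊇` / Howard 2.1.11) at
every number field — the other three conjuncts of the five-conjunct fact are tree theorems
(`poitouTate_selmerStructure_duality_conj_of_canonical_numberField`). CONDITIONAL on the two displayed hypotheses.
[cite: MilneADT2006, Ch. I, Thm. 2.6 and Thm. 4.10(b)] [cite: CasselsFrohlichANT1967, Ch. VII §11] -/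
theorem jetchevMaxDivisibilityAtThreeModThree_of_canonical
    (hUO : ∀ (K : Type) [Field K] [NumberField K] (n : ℕ) [NeZero n],
      (LocalInvariants.canonical K n).UnramifiedOrthogonal)
    (hSC : ∀ (K : Type) [Field K] [NumberField K] (n : ℕ) [NeZero n],
      (LocalInvariants.canonical K n).SelmerComplement) :
    JetchevMaxDivisibilityAtThreeModThree :=
  jetchevMaxDivisibilityAtThreeModThree_of_dualityConj fun K _ _ ↦
    poitouTate_selmerStructure_duality_conj_of_canonical_numberField K (hUO K) (hSC K)

end Summit.BirchSwinnertonDyer.BirchSwinnertonDyer.Theorems.JetchevMaxDivisibilityAtThreeModThreeOfConj
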